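import Literature.Geometry.Lorentzian.NearKerrLeaf
import HarnessLib

/-!
# Stub `stub_holeCount` of line `Sketch` of crux `Capture` (stmt-FinalStateConjecture-10115):
# hole-count stabilisation

The crux `Capture` (routes `BartnikGapSettling` / `QuietWindowCapture`, summit
`FinalStateConjecture`) assumes that a maximal globally hyperbolic development `𝒟` has, for EVERY
regularity `k`, tolerance `ε > 0` and compact `K ⊆ 𝒟`, an `(ε, k)`-near-Kerr leaf `S`
(`CauchyDevelopment.IsNearKerrLeaf`) beyond `J⁻(K)` with `N ≤ N₀` holes, masses in the window
`[m₀, m₀⁻¹]`, and the spin margin `|aᵢ| ≤ χ Mᵢ` once `k₁ ≤ k`, `ε ≤ ε₁`.  This file proves the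
first normal-form step of the line's skeleton (`theorem stub_holeCount`, verbatim the registered
stub of `Summits/FinalStateConjecture/FinalStateConjecture/Cruxes/Capture/Lines/Sketch.lean`):
ONE hole count `N ≤ N₀` serves every `(k, ε, K)`, with the margin at every `(k, ε)`.

Proof (pigeonhole over `N ≤ N₀` + monotonicity).  By contradiction: if every `N ≤ N₀` failed,
choose for each `n : Fin (N₀ + 1)` a witness `(kₙ, εₙ > 0, Kₙ compact)` admitting NO admissible
`n`-hole leaf.  Apply the hypothesis at the common refinement `k' := (univ.sup kₙ) ⊔ k₁`,
`ε' := (univ.inf εₙ) ⊓ ε₁ > 0` (a finite infimum of positive extended reals is positive),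
`K' := ⋃ₙ Kₙ` (a finite union of compact sets is compact): it returns a leaf with some `N ≤ N₀`
holes, masses in the window, the margin (as `k₁ ≤ k'`, `ε' ≤ ε₁`), disjoint from
`J⁻(K') ⊇ J⁻(K_N)` (`J⁻` is monotone in the set, `causalPast_mono`), and an `(ε', k')`-leaf is an
`(ε_N, k_N)`-leaf (`CauchyDevelopment.IsNearKerrLeaf.mono`) — contradicting the witness at `n = N`.
No named facts are used; no definitions are introduced.

References: Dafermos–Holzegel–Rodnianski–Taylor arXiv:2104.08222, §1 (the leaf vocabulary);
O'Neill 1983, Ch. 14 (monotonicity of causal pasts).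
-/

-- the doubled `FinalStateConjecture.FinalStateConjecture` path component trips dupNamespace
set_option linter.dupNamespace false

noncomputable section

namespace Summit.FinalStateConjecture.FinalStateConjecture.Theorems.BartnikGapSettling.Capture

open Set Filter Topology
open scoped Manifold ContDiff ENNReal
open Literature.Geometry.Lorentzian

/-- `J⁻` is monotone in the set: `S ⊆ T → J⁻(S) ⊆ J⁻(T)` (the causal past is the causal future for
the reversed time orientation, and `J⁺` is monotone, `LorentzianMetric.causalFuture_mono`).
O'Neill 1983, Ch. 14, p. 403. [folklore] -/
private theorem causalPast_mono (𝓢 : Spacetime 4) {S T : Set 𝓢.carrier} (h : S ⊆ T) :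
    𝓢.metric.causalPast 𝓢.timeOrientation S ⊆ 𝓢.metric.causalPast 𝓢.timeOrientation T := by
  unfold LorentzianMetric.causalPast
  exact LorentzianMetric.causalFuture_mono h

/-- **Hole-count stabilisation** (stub `stub_holeCount` of line `Sketch`, crux `Capture`,
stmt-FinalStateConjecture-10115): if for every `(k, ε > 0, K compact)` the development `𝒟` has an
`(ε, k)`-near-Kerr leaf beyond `J⁻(K)` with `N ≤ N₀` holes, masses in `[m₀, m₀⁻¹]` and the margin
`|aᵢ| ≤ χ Mᵢ` once `k₁ ≤ k`, `ε ≤ ε₁` (`0 < ε₁`), then ONE hole count `N ≤ N₀` serves every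
`(k, ε, K)`, with the margin at every `(k, ε)`.  Pigeonhole over the `N₀ + 1` hole counts plus
monotonicity of `IsNearKerrLeaf` in `(k, ε)` and of `J⁻` in the set. [folklore] -/
theorem stub_holeCount :
    ∀ (X : Type) [TopologicalSpace X] [ChartedSpace E3 X] [IsManifold (𝓡 3) ∞ X] [ConnectedSpace X]
      (D : InitialDataSet (𝓡 3) X) (𝒟 : VacuumCauchyDevelopment D) (N₀ : ℕ) (m₀ χ : ℝ) (k₁ : ℕ)
      (ε₁ : ℝ≥0∞), 0 < ε₁ →
      (∀ (k : ℕ) (ε : ℝ≥0∞), 0 < ε → ∀ K : Set 𝒟.carrier, IsCompact K →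
        ∃ (N : ℕ) (M a : Fin N → ℝ) (S : Set 𝒟.carrier), N ≤ N₀ ∧ (∀ i, m₀ ≤ M i ∧ M i ≤ m₀⁻¹) ∧
          Disjoint S (𝒟.metric.causalPast 𝒟.timeOrientation K) ∧
            𝒟.toCauchyDevelopment.IsNearKerrLeaf k ε N M a S ∧
              (k₁ ≤ k → ε ≤ ε₁ → ∀ i, |a i| ≤ χ * M i)) →
      ∃ N : ℕ, N ≤ N₀ ∧
        ∀ (k : ℕ) (ε : ℝ≥0∞), 0 < ε → ∀ K : Set 𝒟.carrier, IsCompact K →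
          ∃ (M a : Fin N → ℝ) (S : Set 𝒟.carrier),
            (∀ i, m₀ ≤ M i ∧ M i ≤ m₀⁻¹ ∧ |a i| ≤ χ * M i) ∧
              Disjoint S (𝒟.metric.causalPast 𝒟.timeOrientation K) ∧
                𝒟.toCauchyDevelopment.IsNearKerrLeaf k ε N M a S := by
  intro X _ _ _ _ D 𝒟 N₀ m₀ χ k₁ ε₁ hε₁ H
  by_contra hcon
  push Not at hcon
  -- for each hole count `n ≤ N₀`, a witness `(kₙ, εₙ > 0, Kₙ compact)` with NO admissible
  -- `n`-hole leaf
  choose k ε hε K hK hno using fun n : Fin (N₀ + 1) => hcon n (Nat.le_of_lt_succ n.isLt)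
  -- the common refinement `(k', ε', K')` of the `N₀ + 1` witnesses and of the margin thresholds
  have hε' : 0 < Finset.univ.inf ε ⊓ ε₁ :=
    lt_inf_iff.2 ⟨(Finset.lt_inf_iff ENNReal.zero_lt_top).2 fun n _ => hε n, hε₁⟩
  obtain ⟨N, M, a, S, hN, hwin, hdisj, hleaf, hmar⟩ :=
    H (Finset.univ.sup k ⊔ k₁) (Finset.univ.inf ε ⊓ ε₁) hε' (⋃ n, K n) (isCompact_iUnion hK)
  have hmar' : ∀ i, |a i| ≤ χ * M i := hmar le_sup_right inf_le_right
  have hlt : N < N₀ + 1 := Nat.lt_succ_of_le hN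
  -- the returned `N`-hole leaf is admissible for the witness at `n = N`: contradiction
  exact hno ⟨N, hlt⟩ M a S (fun i => ⟨(hwin i).1, (hwin i).2, hmar' i⟩)
    (hdisj.mono_right (causalPast_mono 𝒟.toSpacetime (subset_iUnion K ⟨N, hlt⟩)))
    (hleaf.mono ((Finset.le_sup (Finset.mem_univ (⟨N, hlt⟩ : Fin (N₀ + 1)))).trans le_sup_left)
      (inf_le_left.trans (Finset.inf_le (Finset.mem_univ (⟨N, hlt⟩ : Fin (N₀ + 1))))))

end Summit.FinalStateConjecture.FinalStateConjecture.Theorems.BartnikGapSettling.Capture
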